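import Summits.BirchSwinnertonDyer.Rank1Residual.X11b.BDPRouteRelaxation
import Summits.BirchSwinnertonDyer.BirchSwinnertonDyer.Theorems.GenusKolyvaginAtTwoPowDvdShaCardAtTwoRTLagrangianReduction
import HarnessLib

/-!
# Route `GenusKolyvaginAtTwo`, crux L_T `PowDvdShaCardAtTwoRT` (stmt-BirchSwinnertonDyer-23242), LINE 18/19 stub 3a⁗, step (b) input I5-DEEP:
# McCALLUM'S AUXILIARY CLASS CAN BE TAKEN DEEP — a class with the prescribed Lagrangian local profile of order ≥ √(#E[p^k]-order at w)

Seat `bsd-line-gk2-p3` g19 (cell `bsd-f1-sign2`), `--supports 23242 --as helper`; sequel of gk2-p4's `…RTAuxiliaryClass` (McCallum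
Prop. 2.1: `c ≠ 0`) and of `…RTLagrangianReduction` (the algebra). THEOREMS ONLY. BSD is not proved by any of this; neither is the crux.

WHY (memo `Cruxes/PowDvdShaCardAtTwoRT/Lines/plus-descent-step-b-levels.md` §1–§2): in McCallum's swap step (proof of Prop. 5.2) the
auxiliary class must be DEEP — of order `≥ p^{M_r+2}` — not merely non-zero, because a level-`p` partner cannot detect
`d_{M_r+1}(nl′)_{λ′}` when `M_r ≥ 1`. The same Poitou–Tate device that proves Prop. 2.1 gives depth: the image `G` of the `T`-relaxed
Selmer group in `Π_{u∈T} H¹(K_u, E[p^k])` is Lagrangian (`annLeft_map_kummerOutside_eq`), so its reduction to the free place `w` through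
LAGRANGIAN local conditions `H_v` (`v ∈ S = T − {w}`) is Lagrangian in `H¹(K_w, E[p^k])` (`annLeft_map_eval_eq`), hence contains, for
every local class `x₀` at `w`, an element `g_w` with `ord x₀ ∣ (ord g_w)²` (`exists_mem_addOrderOf_dvd_sq_eval`).

* `exists_mem_kummerOutside_addOrderOf_dvd_sq` — `K` totally complex, level `p^k`, Weil datum, Poitou–Tate family, Tate's count (the
  hypotheses of gk2-p4's `exists_ne_zero_mem_kummerOutside` VERBATIM, with `hH` strengthened from «half size» to «Lagrangian for
  `inv_v(· ∪ₑ ·)`»): for every `x₀ ∈ H¹(K_w, E[p^k])` there is `c ∈ kummerOutside W (p^k) ((insert w S).map inr)` with `loc_v c ∈ H_v`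
  (`v ∈ S`) and **`addOrderOf x₀ ∣ addOrderOf (loc_w c) ^ 2`**; `_pow` form: `ord x₀ = p^M ⟹ ord (loc_w c) = p^j`, `M ≤ 2j`.

The Lagrangian hypothesis holds for the Kummer condition (isotropy `kummerClass_cupProduct_kummerClass_eq_zero_holds` + Tate's count) and,
at the own Kolyvagin primes over `ℚ` on `Δ < 0`, for the transverse line (`…RTTransverseIsotropic` + count `q · q = q²`); supplying
`x₀` of order `p^k` at a Kolyvagin prime `w` (e.g. the Kummer class of a generator of `E(K_w)/p^k ≅ E[p^k]`) then yields an auxiliary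
class of order `≥ p^{⌈k/2⌉}` — deep for `k ≥ 2M_r + 4`. Not done here: the `ℚ`-version with real places (`Δ < 0`: `H¹(ℝ, E[2^M]) = 0`).

References: [McCallumLMS1991] §2 Prop. 2.1 (proof, p. 300), §5 proof of Prop. 5.2 (pp. 308–310); [MilneADT2006] I Thm. 4.10, Cor. 2.3.
-/

set_option autoImplicit false
-- the Theorems namespace of this sub repeats the summit name by design (D-0017 nested layout)
set_option linter.dupNamespace false

noncomputable section

open scoped Classical

open CategoryTheory Field NumberField IsDedekindDomain Function
open Literature.NumberTheory.EllipticCurves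
open Literature.NumberTheory.GaloisRepresentations
open Literature.NumberTheory.GaloisCohomology
open Summit.BirchSwinnertonDyer.Rank1Residual.X11b.KummerPT
open Summit.BirchSwinnertonDyer.Rank1Residual.X11b.FiniteDuality
open Summit.BirchSwinnertonDyer.Rank1Residual.X11b.Relaxation
open Summit.BirchSwinnertonDyer.BirchSwinnertonDyer.Theorems.GenusExact.LagrangianReduction
open scoped ContRepresentation

namespace Summit.BirchSwinnertonDyer.BirchSwinnertonDyer.Theorems.GenusExact.AuxiliaryClass

section Deep

variable {K : Type} [Field K] [NumberField K] (W : WeierstrassCurve K) [W.IsElliptic] (p k : ℕ)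
  [Fact p.Prime]

variable (e : W.geomTorsion ((p ^ k : ℕ) : ℤ) → W.geomTorsion ((p ^ k : ℕ) : ℤ) → AlgebraicClosure K)
  (hμ : ∀ S T, e S T ^ (p ^ k) = 1)
  (hadd₁ : ∀ S₁ S₂ T, e (S₁ + S₂) T = e S₁ T * e S₂ T)
  (hadd₂ : ∀ S T₁ T₂, e S (T₁ + T₂) = e S T₁ * e S T₂)
  (hgal : ∀ (σ : absoluteGaloisGroup K) (S T : W.geomTorsion ((p ^ k : ℕ) : ℤ)),
    σ • e S T = e (σ • S) (σ • T))
  (halt : ∀ T, e T T = 1) (hnondeg : ∀ T, (∀ S, e S T = 1) → T = 0)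

include e hμ hadd₁ hadd₂ hgal halt hnondeg in
/-- **McCallum's Prop. 2.1, DEEP form.** Setting of `exists_ne_zero_mem_kummerOutside` (`K` totally complex, level `p^k`, Weil datum,
Poitou–Tate family `inv`, Tate's count), with the local conditions `H_v` (`v ∈ S`) LAGRANGIAN for `inv_v(· ∪ₑ ·)`. Then for every
`x₀ ∈ H¹(K_w, E[p^k])` there is a class `c`, Kummer off `S ∪ {w}`, with `loc_v c ∈ H_v` on `S`, whose localisation at the free place
`w` satisfies **`ord x₀ ∣ ord(loc_w c)²`** (so `ord c ≥ ord(loc_w c) ≥ √(ord x₀)`). Proof: Lagrangian reduction of the maximal isotropic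
`G = loc(H¹_{𝓛,⊤ on S∪{w}})` (`annLeft_map_kummerOutside_eq`) through the `H_v`, then `exists_mem_addOrderOf_dvd_sq_eval`.
[cite: McCallumLMS1991, §2 Prop. 2.1 and §5 proof of Prop. 5.2] [cite: MilneADT2006, Ch. I Thm. 4.10] -/
theorem exists_mem_kummerOutside_addOrderOf_dvd_sq (hK : ∀ w : InfinitePlace K, w.IsComplex)
    {inv : LocalInvariants K (p ^ k)} (hperf : inv.IsPerfect) (hsum : inv.SumLocalTermEqZero)
    (hcompl : inv.SelmerComplement)
    (hEuler : ∀ v : HeightOneSpectrum (𝓞 K),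
      Nat.card (galoisCohomology ((W.torsionGaloisModule ((p ^ k : ℕ) : ℤ)).toLocal (Sum.inr v)) 1) =
        (Nat.card (nsmulAddMonoidHom (p ^ k) :
            (W.baseChange (v.adicCompletion K)).toAffine.Point →+ _).ker *
          Nat.card (v.adicCompletionIntegers K ⧸
            Ideal.span {((p ^ k : ℕ) : v.adicCompletionIntegers K)})) ^ 2)
    (S : Finset (HeightOneSpectrum (𝓞 K))) (w : HeightOneSpectrum (𝓞 K)) (hwS : w ∉ S)
    (H : ∀ v : HeightOneSpectrum (𝓞 K),
      AddSubgroup (galoisCohomology ((W.torsionGaloisModule ((p ^ k : ℕ) : ℤ)).toLocal (Sum.inr v)) 1))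
    (hH : ∀ v ∈ S, annLeft (invWeilPairing W (p ^ k) e hμ hadd₁ hadd₂ hgal inv (Sum.inr v)) (H v) = H v)
    (x₀ : galoisCohomology ((W.torsionGaloisModule ((p ^ k : ℕ) : ℤ)).toLocal (Sum.inr w)) 1) :
    ∃ c ∈ kummerOutside W (p ^ k) ((insert w S).map Function.Embedding.inr),
      (∀ v ∈ S, galoisCohomology.localization (W.torsionGaloisModule ((p ^ k : ℕ) : ℤ)) (Sum.inr v) 1 c ∈ H v) ∧
      addOrderOf x₀ ∣
        addOrderOf (galoisCohomology.localization (W.torsionGaloisModule ((p ^ k : ℕ) : ℤ)) (Sum.inr w) 1 c) ^ 2 := by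
  classical
  -- index type `T = S ∪ {w}`, coordinates, sum pairing
  set X : ↥(insert w S) → Type := fun u ↦ galoisCohomology ((W.torsionGaloisModule ((p ^ k : ℕ) : ℤ)).toLocal
      (Sum.inr (u : HeightOneSpectrum (𝓞 K)))) 1 with hXdef
  obtain ⟨loc, hloc⟩ : ∃ loc : galoisCohomology (W.torsionGaloisModule ((p ^ k : ℕ) : ℤ)) 1 →+ (∀ u, X u),
      ∀ c u, loc c u = galoisCohomology.localization (W.torsionGaloisModule ((p ^ k : ℕ) : ℤ))
        (Sum.inr (u : HeightOneSpectrum (𝓞 K))) 1 c :=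
    ⟨AddMonoidHom.pi fun u ↦ galoisCohomology.localization (W.torsionGaloisModule ((p ^ k : ℕ) : ℤ))
      (Sum.inr (u : HeightOneSpectrum (𝓞 K))) 1, fun c u ↦ rfl⟩
  haveI hfin : ∀ u : HeightOneSpectrum (𝓞 K), Finite (galoisCohomology
      ((W.torsionGaloisModule ((p ^ k : ℕ) : ℤ)).toLocal (Sum.inr u)) 1) :=
    fun u ↦ finite_galoisCohomology_toLocal_inr W (p ^ k) u
  haveI : ∀ u : ↥(insert w S), Finite (X u) := fun u ↦ hfin u
  have hX : ∀ (u : ↥(insert w S)) (x : X u), (p ^ k) • x = 0 :=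
    fun u x ↦ nsmul_galoisCohomology_toLocal_eq_zero W (p ^ k) _ x
  set b : ∀ u : ↥(insert w S), X u →+ X u →+ ZMod (p ^ k) :=
    fun u ↦ invWeilPairing W (p ^ k) e hμ hadd₁ hadd₂ hgal inv (Sum.inr (u : HeightOneSpectrum (𝓞 K))) with hbdef
  have hb : ∀ u, Injective (b u) := fun u ↦
    (invWeilPairing_bijective W (p ^ k) e hμ hadd₁ hadd₂ hgal hnondeg inv (u : HeightOneSpectrum (𝓞 K)) (hperf u).1.1).1
  have hbflip : ∀ u, Injective (b u).flip := fun u ↦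
    (invWeilPairing_flip_bijective W (p ^ k) e hμ hadd₁ hadd₂ hgal hnondeg inv (u : HeightOneSpectrum (𝓞 K))
      (hperf u).1.1).1
  obtain ⟨bP, hbP⟩ := exists_piSum b
  -- `G` is Lagrangian
  have hG := annLeft_map_kummerOutside_eq W p k e hμ hadd₁ hadd₂ hgal halt hnondeg hK hperf hsum hcompl hEuler (insert w S)
    loc hloc bP hbP
  -- reduction to the coordinate `w`
  set w' : ↥(insert w S) := ⟨w, Finset.mem_insert_self w S⟩ with hw'def
  set H' : ∀ u : ↥(insert w S), AddSubgroup (X u) := fun u ↦ H u with hH'def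
  have hH' : ∀ u : ↥(insert w S), u ≠ w' → annLeft (b u) (H' u) = H' u := by
    intro u hu
    have huS : (u : HeightOneSpectrum (𝓞 K)) ∈ S := by
      rcases Finset.mem_insert.mp u.2 with h | h
      · exact absurd (Subtype.ext h) hu
      · exact h
    exact hH u huS
  obtain ⟨g, hgG, hgH, hdvd⟩ := exists_mem_addOrderOf_dvd_sq_eval hX b hb hbflip bP hbP w' H' hH'
    ((kummerOutside W (p ^ k) ((insert w S).map Function.Embedding.inr)).map loc) hG x₀
  obtain ⟨c, hc, rfl⟩ := hgG
  refine ⟨c, hc, fun v hv ↦ ?_, ?_⟩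
  · have hne : (⟨v, Finset.mem_insert_of_mem hv⟩ : ↥(insert w S)) ≠ w' := by
      intro h
      apply hwS
      have hv' : v = w := congrArg Subtype.val h
      rwa [hv'] at hv
    have h := hgH ⟨v, Finset.mem_insert_of_mem hv⟩ hne
    rwa [hloc] at h
  · rwa [hloc] at hdvd

include e hμ hadd₁ hadd₂ hgal halt hnondeg in
/-- **Deep Prop. 2.1, `p`-power form**: with `x₀ ∈ H¹(K_w, E[p^k])` of order `p^M`, the auxiliary class has `ord(loc_w c) = p^j`
with `M ≤ 2j`; in particular `ord c ≥ p^{⌈M/2⌉}`. (For the swap step at depth `M_r` take `k = M ≥ 2M_r + 4` and `x₀` of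
order `p^M`.) [cite: McCallumLMS1991, §2 Prop. 2.1 and §5 proof of Prop. 5.2] -/
theorem exists_mem_kummerOutside_addOrderOf_eq_pow (hK : ∀ w : InfinitePlace K, w.IsComplex)
    {inv : LocalInvariants K (p ^ k)} (hperf : inv.IsPerfect) (hsum : inv.SumLocalTermEqZero)
    (hcompl : inv.SelmerComplement)
    (hEuler : ∀ v : HeightOneSpectrum (𝓞 K),
      Nat.card (galoisCohomology ((W.torsionGaloisModule ((p ^ k : ℕ) : ℤ)).toLocal (Sum.inr v)) 1) =
        (Nat.card (nsmulAddMonoidHom (p ^ k) :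
            (W.baseChange (v.adicCompletion K)).toAffine.Point →+ _).ker *
          Nat.card (v.adicCompletionIntegers K ⧸
            Ideal.span {((p ^ k : ℕ) : v.adicCompletionIntegers K)})) ^ 2)
    (S : Finset (HeightOneSpectrum (𝓞 K))) (w : HeightOneSpectrum (𝓞 K)) (hwS : w ∉ S)
    (H : ∀ v : HeightOneSpectrum (𝓞 K),
      AddSubgroup (galoisCohomology ((W.torsionGaloisModule ((p ^ k : ℕ) : ℤ)).toLocal (Sum.inr v)) 1))
    (hH : ∀ v ∈ S, annLeft (invWeilPairing W (p ^ k) e hμ hadd₁ hadd₂ hgal inv (Sum.inr v)) (H v) = H v)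
    {x₀ : galoisCohomology ((W.torsionGaloisModule ((p ^ k : ℕ) : ℤ)).toLocal (Sum.inr w)) 1} {M : ℕ}
    (hx₀ : addOrderOf x₀ = p ^ M) :
    ∃ c ∈ kummerOutside W (p ^ k) ((insert w S).map Function.Embedding.inr),
      (∀ v ∈ S, galoisCohomology.localization (W.torsionGaloisModule ((p ^ k : ℕ) : ℤ)) (Sum.inr v) 1 c ∈ H v) ∧
      ∃ j : ℕ, addOrderOf (galoisCohomology.localization (W.torsionGaloisModule ((p ^ k : ℕ) : ℤ)) (Sum.inr w) 1 c) = p ^ j ∧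
        M ≤ 2 * j := by
  obtain ⟨c, hc, hcH, hdvd⟩ := exists_mem_kummerOutside_addOrderOf_dvd_sq W p k e hμ hadd₁ hadd₂ hgal halt hnondeg hK
    hperf hsum hcompl hEuler S w hwS H hH x₀
  haveI := finite_galoisCohomology_toLocal_inr W (p ^ k) w
  have hr' : addOrderOf (galoisCohomology.localization (W.torsionGaloisModule ((p ^ k : ℕ) : ℤ)) (Sum.inr w) 1 c) ∣
      p ^ k := addOrderOf_dvd_of_nsmul_eq_zero (nsmul_galoisCohomology_toLocal_eq_zero W (p ^ k) _ _)
  obtain ⟨j, -, hrj⟩ := (Nat.dvd_prime_pow (Fact.out : p.Prime)).mp hr'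
  refine ⟨c, hc, hcH, j, hrj, ?_⟩
  rw [hx₀, hrj, ← pow_mul] at hdvd
  have h := (Nat.pow_dvd_pow_iff_le_right (Fact.out : p.Prime).one_lt).mp hdvd
  omega

end Deep

end Summit.BirchSwinnertonDyer.BirchSwinnertonDyer.Theorems.GenusExact.AuxiliaryClass

end
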